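import Mathlib
import HarnessLib
import Summits.HubbardSuperconductivity.HubbardSuperconductivity.Theorems.KLProgrammeKLRegimeEngineTwoLegStepV17F2ClosersGridBinder
import Summits.HubbardSuperconductivity.HubbardSuperconductivity.Theorems.KLProgrammeKLRegimeEngineV8TwoLegMomentsExportGridC

/-!
# Route `KLProgramme` — ENGINE child gen 8 (stmt-HubbardSuperconductivity-20437 `KLRegimeEngineV17F2`), stub (e) `stub_twoLeg_step` under the (T′-B) text of
# located risk #9 (plan g20 (R60)/(R60d), token #27 `TwoLegGridMomentsAtC`): THE (e) CLOSER TWIN MODULO THE VL ROWS, mixed space-row currency, ONE c-row (#28)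
# (cell gate-hubbard-kl, seat hubbard-kl-r2d-p1 g9 = (e) lane + class-#7 text owner)

This is p563755 `stub_twoLeg_step_of_gridBinder_dualRows_raise` with the grid binder `hGs` RE-KEYED to the successor atom
`TwoLegGridMomentsAtC L₁ M₁ Zt Zs₁ Zs₂ c β U μ (K_{n'}) n'` (space row `(Zs₁·ĉ·|U| + Zs₂·U²)·β/(2N)`, `ĉ = c/ln 4 + U²`; …ExportGridC), the currency
literals as PARAMETERS with their rows `hZa : Zt ≤ 2¹⁰e¹⁸κ₀⁴·klE3Acum R`, `hS₂a : Zs₂ ≤ 2¹¹e¹⁸κ₀⁴·klE3Acum R` (no sign row on `Zs₁`), and ONE extra row (token #28, mode (β) with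
a literal): **`hrow : Zs₁·(c/ln 4 + U²) ≤ min (R.cz/600) (1/10)`**.  Why `1/600`: the registered U-door `klE3U₀all` spends `23/200·cz|U|` of the B2′ fit
`m₁′ + 4/3·Gfr₁U² ≤ cz|U|·cDtmin(−1.2,−0.05)/2` on the `U²` part; `cDtmin(−1.2,−0.05)/2 ≥ 7/60 = 23/200 + 1/600` (`seven_div_sixty_le_half_cDtmin_wide`, the
window lemma sharpened from `23/100` to `7/30`) leaves `cz|U|/600` for the `ĉ·|U|` part; the `1/10` half keeps the nested-leg smallness `≤ klCurveD`.

**`stub_twoLeg_step_of_gridBinderC_dualRows_raise`** ⟹ `TwoLegStepV17F2 L M klEngGeo8 P Q R β U μ n`.  Discharged inside: B1′ (`fieldStrength` fit from the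
time row, unchanged), B2′ (`twoLeg_slopeSizes_of_twoLegGridMomentsAtC` + the split fit), rows C1/C2 (`cutLeg_/spLeg_allScales_of_gridMoments_V17F2_geometric4` fed by
`hGs … |>.toMomentsAt` at `Zs := Zs₁ĉ/|U| + Zs₂`, smallness `twoLeg_gridLegSmallnessC_of_doors`), the raise bookkeeping as in p563755; `mixedRow_of_thresholds` = the arithmetic of the successor's `_of_thresholds`
wrapper ((R60f): `hrow` from `c ≤ klEngC₃7`, `U ≤ klEngU₀11` by `min_le`).

Proofs only; no definitions; nothing about the model is asserted; nothing asserts any stub of 20437, K3 or superconductivity.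
References: BGM 2006 §2.4 (2.23), (2.36), §3 [cite: BenfattoGiulianiMastropietro2006].
-/

noncomputable section

namespace Summit.HubbardSuperconductivity.HubbardSuperconductivity.Theorems.EngineV8

set_option linter.dupNamespace false -- summit = problem name (single-conjunct summit), D-0017

open Real Finset Complex Literature.MathematicalPhysics.QuantumLattice Literature.Probability.LatticeModels GrassmannAlgebra
open Literature.MathematicalPhysics.QuantumLattice.FermiRG Literature.MathematicalPhysics.QuantumLattice.BandSectorCounting
open Summit.HubbardSuperconductivity.HubbardSuperconductivity.Theorems.KLProgrammeLegKernels
open Summit.HubbardSuperconductivity.HubbardSuperconductivity.Theorems.DispersionFlow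
open Summit.HubbardSuperconductivity.HubbardSuperconductivity.Theorems.PerturbedFermiCurve
open Summit.HubbardSuperconductivity.HubbardSuperconductivity.Theorems.KLRegimeSplit
open Summit.HubbardSuperconductivity.HubbardSuperconductivity.Theorems.TwoPointAssembly
open Summit.HubbardSuperconductivity.HubbardSuperconductivity.Theorems.TwoVolumeDefect
open Summit.HubbardSuperconductivity.HubbardSuperconductivity.Theorems.TwoLegFourier

/-! ## §1 The two numeric doors of the mixed currency -/

/-- **The wide window's transversality, sharpened**: `7/30 ≤ cDtmin (−1.2) (−0.05)` (the tree's `cDtmin_wide_ge` has `23/100`; both from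
`klfs_cDtmin_ge`: `√(0.05·3.95)·√2.8/π ≥ 0.4444·1.6733/3.15`). -/
theorem seven_div_thirty_le_cDtmin_wide : (7 : ℝ) / 30 ≤ cDtmin (-1.2) (-0.05) := by
  have h := klfs_cDtmin_ge (a := (-1.2 : ℝ)) (b := (-0.05 : ℝ)) (by norm_num) (by norm_num)
  have h1 : (0.4444 : ℝ) ≤ Real.sqrt (-(-0.05 : ℝ) * (4 + (-0.05))) := Real.le_sqrt_of_sq_le (by norm_num)
  have h2 : (1.6733 : ℝ) ≤ Real.sqrt ((-1.2 : ℝ) + 4) := Real.le_sqrt_of_sq_le (by norm_num)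
  have hπ := Real.pi_lt_d2
  have hπ0 := Real.pi_pos
  have h3 : (7 : ℝ) / 30 ≤ Real.sqrt (-(-0.05 : ℝ) * (4 + (-0.05))) * Real.sqrt ((-1.2 : ℝ) + 4) / π := by
    rw [le_div_iff₀ hπ0]
    nlinarith [Real.sqrt_nonneg (-(-0.05 : ℝ) * (4 + (-0.05))), Real.sqrt_nonneg ((-1.2 : ℝ) + 4)]
  exact h3.trans h

/-- `7/60 ≤ cDtmin(−1.2,−0.05)/2`, i.e. the B2′ fit has `23/200 + 1/600` of room per `cz·|U|`. -/
theorem seven_div_sixty_le_half_cDtmin_wide : (7 : ℝ) / 60 ≤ cDtmin (-1.2) (-0.05) / 2 := by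
  linarith [seven_div_thirty_le_cDtmin_wide]

/-- **The U-door's share of the B2′ fit, explicit**: `U ≤ klE3U₀all R` gives `(2¹¹e¹⁸κ₀⁴·klE3Acum R + 4/3·Gfr₁)·U² ≤ (23/200)·cz·|U|` (`0 < U`). -/
theorem spaceLit_mul_sq_le_of_klE3U₀all {R : RenConsts} {U : ℝ} (hU : 0 < U) (hUall : U ≤ klE3U₀all R) :
    ((2 : ℝ) ^ 11 * Real.exp 1 ^ 18 * Real.sqrt (2 * (7 + 1606732)) ^ 4 * klE3Acum R + 4 / 3 * R.Gfr 1) * U ^ 2 ≤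
      23 / 200 * (R.cz * |U|) := by
  have hA := klE3Acum_pos R
  set lit : ℝ := (2 : ℝ) ^ 11 * Real.exp 1 ^ 18 * Real.sqrt (2 * (7 + 1606732)) ^ 4 * klE3Acum R with hlit
  have hlit0 : 0 < lit := by rw [hlit]; positivity
  have hD0 : 0 < lit + 4 / 3 * |R.Gfr 1| + 1 := by positivity
  have hU2 : U ≤ R.cz * (23 / 200) / (lit + 4 / 3 * |R.Gfr 1| + 1) := hUall.trans (min_le_right _ _)
  have h1 : U * (lit + 4 / 3 * |R.Gfr 1| + 1) ≤ R.cz * (23 / 200) := (le_div_iff₀ hD0).1 hU2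
  have hG : R.Gfr 1 ≤ |R.Gfr 1| := le_abs_self _
  rw [abs_of_pos hU]
  have h2 : (lit + 4 / 3 * R.Gfr 1) * U ≤ R.cz * (23 / 200) := by nlinarith [hU.le]
  nlinarith [hU.le]

/-- **THE MIXED-CURRENCY B2′ FIT** from the rows: `0 ≤ Zs₁`, `Zs₁·ĉ ≤ cz/600`, `Zs₂ ≤ 2¹¹e¹⁸κ₀⁴·klE3Acum R`, `U ≤ klE3U₀all R` ⇒
`Zs₁·ĉ·|U| + Zs₂·U² + 4/3·Gfr₁·U² ≤ cz·|U|·cDtmin(−1.2,−0.05)/2`. -/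
theorem mixed_slope_fit {R : RenConsts} (hcz : 0 < R.cz) {U c Zs₁ Zs₂ : ℝ} (hU : 0 < U) (hUall : U ≤ klE3U₀all R)
    (hrow : Zs₁ * (c / Real.log 4 + U ^ 2) ≤ R.cz / 600)
    (hS₂a : Zs₂ ≤ (2 : ℝ) ^ 11 * Real.exp 1 ^ 18 * Real.sqrt (2 * (7 + 1606732)) ^ 4 * klE3Acum R) :
    Zs₁ * (c / Real.log 4 + U ^ 2) * |U| + Zs₂ * U ^ 2 + 4 / 3 * R.Gfr 1 * U ^ 2 ≤ R.cz * |U| * (cDtmin (-1.2) (-0.05) / 2) := by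
  have h23 := spaceLit_mul_sq_le_of_klE3U₀all hU hUall
  rw [add_mul] at h23
  have hczU : 0 ≤ R.cz * |U| := by positivity
  have h7' : R.cz * |U| * (7 / 60) ≤ R.cz * |U| * (cDtmin (-1.2) (-0.05) / 2) :=
    mul_le_mul_of_nonneg_left seven_div_sixty_le_half_cDtmin_wide hczU
  have hA : Zs₁ * (c / Real.log 4 + U ^ 2) * |U| ≤ R.cz * |U| * (1 / 600) :=
    calc Zs₁ * (c / Real.log 4 + U ^ 2) * |U| ≤ R.cz / 600 * |U| := mul_le_mul_of_nonneg_right hrow (abs_nonneg U)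
      _ = R.cz * |U| * (1 / 600) := by ring
  have h2 : Zs₂ * U ^ 2 ≤ (2 : ℝ) ^ 11 * Real.exp 1 ^ 18 * Real.sqrt (2 * (7 + 1606732)) ^ 4 * klE3Acum R * U ^ 2 :=
    mul_le_mul_of_nonneg_right hS₂a (sq_nonneg U)
  have hB : Zs₂ * U ^ 2 + 4 / 3 * R.Gfr 1 * U ^ 2 ≤ 23 / 200 * (R.cz * |U|) := (add_le_add h2 le_rfl).trans h23
  calc Zs₁ * (c / Real.log 4 + U ^ 2) * |U| + Zs₂ * U ^ 2 + 4 / 3 * R.Gfr 1 * U ^ 2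
      = Zs₁ * (c / Real.log 4 + U ^ 2) * |U| + (Zs₂ * U ^ 2 + 4 / 3 * R.Gfr 1 * U ^ 2) := by ring
    _ ≤ R.cz * |U| * (1 / 600) + 23 / 200 * (R.cz * |U|) := add_le_add hA hB
    _ = R.cz * |U| * (7 / 60) := by ring
    _ ≤ R.cz * |U| * (cDtmin (-1.2) (-0.05) / 2) := h7'

/-- **THE MIXED-CURRENCY NESTED-LEG SMALLNESS** from the rows: `Zs₁·ĉ ≤ 1/10`, `Zs₂ ≤ 2¹¹e¹⁸κ₀⁴·klE3Acum R`, `U ≤ klE3U₀all R`,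
`U ≤ klCurveU0 R` ⇒ `(Zs₁·ĉ/|U| + Zs₂)·U² + 4/3·Gfr₁·U² ≤ klCurveD` (`1/10 + 1/64 + 1/90 ≤ 33/200`; no sign needed on `Zs₁`). -/
theorem twoLeg_gridLegSmallnessC_of_doors {R : RenConsts} (hG0 : 0 ≤ R.Gfr 0) (hG1 : 0 ≤ R.Gfr 1) {U c Zs₁ Zs₂ : ℝ} (hU : 0 < U)
    (hUall : U ≤ klE3U₀all R) (hUc : U ≤ klCurveU0 R) (hrow : Zs₁ * (c / Real.log 4 + U ^ 2) ≤ 1 / 10)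
    (hS₂a : Zs₂ ≤ (2 : ℝ) ^ 11 * Real.exp 1 ^ 18 * Real.sqrt (2 * (7 + 1606732)) ^ 4 * klE3Acum R) :
    (Zs₁ * (c / Real.log 4 + U ^ 2) / |U| + Zs₂) * U ^ 2 + 4 / 3 * R.Gfr 1 * U ^ 2 ≤ klCurveD := by
  rw [mixedSpaceBudget_mul_sq hU.ne']
  have hUone : U ≤ 1 := hUc.trans (klCurveU0_le_one R)
  have habs : |U| = U := abs_of_pos hU
  -- the `ĉ` part: `≤ |U|/10 ≤ 1/10`
  have h1 : Zs₁ * (c / Real.log 4 + U ^ 2) * |U| ≤ 1 / 10 := by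
    rw [habs]
    calc Zs₁ * (c / Real.log 4 + U ^ 2) * U ≤ 1 / 10 * U := mul_le_mul_of_nonneg_right hrow hU.le
      _ ≤ 1 / 10 * 1 := mul_le_mul_of_nonneg_left hUone (by norm_num)
      _ = 1 / 10 := by ring
  -- the `U²` part: the old door gives `lit·U² + 4/3Gfr₁U² ≤ klCurveD`, but we need its SLACK: re-derive `lit·U² ≤ 1/64`, `4/3·Gfr₁·U² ≤ 1/90`, `klCurveD ≥ 33/200`
  have hA40 := two_pow_40_le_klE3Acum R
  have hA : 0 < klE3Acum R := klE3Acum_pos R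
  set κ : ℝ := 64 * Real.exp 1 ^ 9 * Real.sqrt (2 * (7 + 1606732)) ^ 2 with hκ
  have hκ0 : 0 < κ := by rw [hκ]; positivity
  have hU1 : U ≤ 1 / (κ * klE3Acum R) := by
    refine hUall.trans ?_
    unfold klE3U₀all
    rw [hκ]
    exact (min_le_left _ _).trans (le_of_eq (by ring))
  have hκAU : κ * klE3Acum R * U ≤ 1 := by
    have := mul_le_mul_of_nonneg_left hU1 (le_of_lt (mul_pos hκ0 hA))
    rwa [mul_one_div_cancel (ne_of_gt (mul_pos hκ0 hA))] at this
  have hκU : κ * U ≤ 1 / klE3Acum R := by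
    rw [le_div_iff₀ hA]
    calc κ * U * klE3Acum R = κ * klE3Acum R * U := by ring
      _ ≤ 1 := hκAU
  have hfirst : (2 : ℝ) ^ 11 * Real.exp 1 ^ 18 * Real.sqrt (2 * (7 + 1606732)) ^ 4 * klE3Acum R * U ^ 2 ≤ 1 / 64 := by
    have hid : (2 : ℝ) ^ 11 * Real.exp 1 ^ 18 * Real.sqrt (2 * (7 + 1606732)) ^ 4 * klE3Acum R * U ^ 2 =
        (κ * klE3Acum R * U) * (κ * U) / 2 := by rw [hκ]; ring
    rw [hid]
    have h1' : (κ * klE3Acum R * U) * (κ * U) ≤ 1 * (1 / klE3Acum R) := mul_le_mul hκAU hκU (by positivity) zero_le_one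
    have h2' : 1 / klE3Acum R ≤ 1 / (2 : ℝ) ^ 40 := one_div_le_one_div_of_le (by positivity) hA40
    have h3' : (1 : ℝ) / 2 ^ 40 ≤ 1 / 32 := by norm_num
    linarith
  have h2 : Zs₂ * U ^ 2 ≤ 1 / 64 := (mul_le_mul_of_nonneg_right hS₂a (sq_nonneg U)).trans hfirst
  have hκ5 : klCurveKappa ≤ 1 / 5 := min_le_right _ _
  have hGU : R.Gfr 1 * U ≤ 1 / 120 := by
    have hden : 0 < 24 * (R.Gfr 0 + R.Gfr 1 + 1) := by positivity
    have hU2 : U ≤ klCurveKappa / (24 * (R.Gfr 0 + R.Gfr 1 + 1)) := hUc.trans (min_le_right _ _)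
    have h1' : U * (24 * (R.Gfr 0 + R.Gfr 1 + 1)) ≤ klCurveKappa := (le_div_iff₀ hden).1 hU2
    nlinarith [mul_nonneg hG0 hU.le, hU.le]
  have h3 : 4 / 3 * R.Gfr 1 * U ^ 2 ≤ 1 / 90 := by
    have h1' : R.Gfr 1 * U ^ 2 ≤ R.Gfr 1 * U := by
      have : U ^ 2 ≤ U := by nlinarith
      exact mul_le_mul_of_nonneg_left this hG1
    nlinarith
  have hD : (33 : ℝ) / 200 ≤ klCurveD := by unfold klCurveD; linarith [cDtmin_window_ge]
  linarith


/-- **THE #28 ROW FROM THRESHOLDS** (the arithmetic of the successor seat's `_of_thresholds` wrapper; (R60f): `klEngC₃7 P R := min klEngC₃6 (min (cz·ln4/(1200(Zs₁+1)))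
(ln4/(20(Zs₁+1))))`, `klEngU₀11 ∋ cz/(1200(Zs₁+1)) ⊓ 1/(20(Zs₁+1))`): `0 ≤ Zs₁`, `0 < U ≤ 1`, `c ≤ cz·ln 4/(1200·(Zs₁+1))`, `c ≤ ln 4/(20·(Zs₁+1))`,
`U ≤ cz/(1200·(Zs₁+1))`, `U ≤ 1/(20·(Zs₁+1))` ⇒ `Zs₁·(c/ln 4 + U²) ≤ min (cz/600) (1/10)`. -/
theorem mixedRow_of_thresholds {Zs₁ c U cz : ℝ} (hZ : 0 ≤ Zs₁) (hU : 0 < U) (hU1 : U ≤ 1)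
    (hc1 : c ≤ cz * Real.log 4 / (1200 * (Zs₁ + 1))) (hc2 : c ≤ Real.log 4 / (20 * (Zs₁ + 1)))
    (hU2 : U ≤ cz / (1200 * (Zs₁ + 1))) (hU3 : U ≤ 1 / (20 * (Zs₁ + 1))) :
    Zs₁ * (c / Real.log 4 + U ^ 2) ≤ min (cz / 600) (1 / 10) := by
  have hlog : 0 < Real.log 4 := Real.log_pos (by norm_num)
  have hZ1 : 0 < Zs₁ + 1 := by linarith
  have hfrac : Zs₁ / (Zs₁ + 1) ≤ 1 := by rw [div_le_one hZ1]; linarith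
  have hfrac0 : 0 ≤ Zs₁ / (Zs₁ + 1) := by positivity
  -- `Zs₁·c/ln4 ≤ Zs₁/(Zs₁+1)·X ≤ X` for both caps
  have hc1' : Zs₁ * (c / Real.log 4) ≤ Zs₁ / (Zs₁ + 1) * (cz / 1200) := by
    have h := mul_le_mul_of_nonneg_left (div_le_div_of_nonneg_right hc1 hlog.le) hZ
    refine h.trans (le_of_eq ?_)
    field_simp
  have hc2' : Zs₁ * (c / Real.log 4) ≤ Zs₁ / (Zs₁ + 1) * (1 / 20) := by
    have h := mul_le_mul_of_nonneg_left (div_le_div_of_nonneg_right hc2 hlog.le) hZ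
    refine h.trans (le_of_eq ?_)
    field_simp
  -- `Zs₁·U² ≤ Zs₁·U ≤ Zs₁/(Zs₁+1)·X`
  have hUU : U ^ 2 ≤ U := by nlinarith
  have hU2' : Zs₁ * U ^ 2 ≤ Zs₁ / (Zs₁ + 1) * (cz / 1200) := by
    calc Zs₁ * U ^ 2 ≤ Zs₁ * U := mul_le_mul_of_nonneg_left hUU hZ
      _ ≤ Zs₁ * (cz / (1200 * (Zs₁ + 1))) := mul_le_mul_of_nonneg_left hU2 hZ
      _ = Zs₁ / (Zs₁ + 1) * (cz / 1200) := by field_simp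
  have hU3' : Zs₁ * U ^ 2 ≤ Zs₁ / (Zs₁ + 1) * (1 / 20) := by
    calc Zs₁ * U ^ 2 ≤ Zs₁ * U := mul_le_mul_of_nonneg_left hUU hZ
      _ ≤ Zs₁ * (1 / (20 * (Zs₁ + 1))) := mul_le_mul_of_nonneg_left hU3 hZ
      _ = Zs₁ / (Zs₁ + 1) * (1 / 20) := by field_simp
  refine le_min ?_ ?_
  · -- the `cz` cap; `cz` may be of any sign here only through the hypotheses, so bound via the fraction ≤ 1 when `0 ≤ cz`, else the hypotheses force it
    have hcz : 0 ≤ cz := by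
      have : 0 < cz / (1200 * (Zs₁ + 1)) := hU.trans_le hU2
      have h1200 : (0 : ℝ) < 1200 * (Zs₁ + 1) := by positivity
      exact (le_of_lt ((div_pos_iff_of_pos_right h1200).1 this))
    calc Zs₁ * (c / Real.log 4 + U ^ 2) = Zs₁ * (c / Real.log 4) + Zs₁ * U ^ 2 := by ring
      _ ≤ Zs₁ / (Zs₁ + 1) * (cz / 1200) + Zs₁ / (Zs₁ + 1) * (cz / 1200) := add_le_add hc1' hU2'
      _ = Zs₁ / (Zs₁ + 1) * (cz / 600) := by ring
      _ ≤ 1 * (cz / 600) := mul_le_mul_of_nonneg_right hfrac (by positivity)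
      _ = cz / 600 := one_mul _
  · calc Zs₁ * (c / Real.log 4 + U ^ 2) = Zs₁ * (c / Real.log 4) + Zs₁ * U ^ 2 := by ring
      _ ≤ Zs₁ / (Zs₁ + 1) * (1 / 20) + Zs₁ / (Zs₁ + 1) * (1 / 20) := add_le_add hc2' hU3'
      _ = Zs₁ / (Zs₁ + 1) * (1 / 10) := by ring
      _ ≤ 1 * (1 / 10) := mul_le_mul_of_nonneg_right hfrac (by positivity)
      _ = 1 / 10 := one_mul _

/-! ## §2 The (e) closer twin under (T′-B) -/

/-- **STUB (e) UNDER (T′-B), MODULO THE VL ROWS, RAISE-GENERIC** (twin of p563755 `stub_twoLeg_step_of_gridBinder_dualRows_raise`).  Package: any raise `Q` of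
`klEngQ7 P R`, geometry `klEngGeo8`, reading-jet table `cJ ≤ klEngGeo7.S`.  Binders: stub (e)'s v2 list + `hJ` + the grid binder `hGs` IN THE C-ATOM CURRENCY at parameters
`(Zt, Zs₁, Zs₂)` with rows `hZa`, `hS₂a`, the #28 row `hrow : Zs₁·ĉ ≤ min (cz/600) (1/10)`, and the VL (D) rows `hdualSp`/`hdualCut` with allowances for a seed
`0 ≤ d ≤ Q.CL β 0/4` ⟹ `TwoLegStepV17F2 L M klEngGeo8 P Q R β U μ n`. -/
theorem stub_twoLeg_step_of_gridBinderC_dualRows_raise (P : SplitConsts) (R : RenConsts) (c : ℝ) (Q : EngConsts)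
    (hQ : (klEngQ7 P R).IsRaiseOf Q) (cJ : ℕ → ℝ) (hC : ∀ k, cJ k ≤ klEngGeo7.S k) (hP : P.WF) (hR : R.WF2) (hc : 0 < c)
    (hc3 : c ≤ klEngC₃6 P R) (μ : ℝ) (hμ : μ ∈ klWindowC) (U : ℝ) (hU : 0 < U) (hUle : U ≤ klEngU₀10 P R c) (β : ℝ) (hβ : klBetaMin ≤ β)
    (hβc : β ≤ Real.exp (c / U ^ 2)) (L M : ℕ) [NeZero L] [NeZero M] (hL : klEngL₄ P R β U ≤ L) (hM : klEngM₃ β U L ≤ M)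
    (n : ℕ) (hn1 : 1 ≤ n) (hn : n ≤ nScales β + 1) (hreg : IsKLRegime U c (-(n : ℤ)))
    (hhist : HistP klPredsV17F2 L M klEngGeo8 P Q R β U μ 0 n)
    (hfr : FrameOK R U (nScales β) μ (klFlowFrameU L M β U μ n))
    (hE : EngineBoundsAtV17F2 L M klEngGeo8 P Q β U μ n)
    (hJ : TwoLegReadJetBound L M cJ (klC4aJetC' P R) β U μ (klFlowFrameU L M β U μ n) n)
    {Zt Zs₁ Zs₂ : ℝ} (hZa : Zt ≤ (2 : ℝ) ^ 10 * Real.exp 1 ^ 18 * Real.sqrt (2 * (7 + 1606732)) ^ 4 * klE3Acum R)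
    (hS₂a : Zs₂ ≤ (2 : ℝ) ^ 11 * Real.exp 1 ^ 18 * Real.sqrt (2 * (7 + 1606732)) ^ 4 * klE3Acum R)
    (hrow : Zs₁ * (c / Real.log 4 + U ^ 2) ≤ min (R.cz / 600) (1 / 10))
    (hGs : ∀ n' ≤ n, ∀ (L₁ M₁ : ℕ) [NeZero L₁] [NeZero M₁], L ≤ L₁ → Q.M0 β L₁ ≤ M₁ →
      (∀ j < n', histV17F2 L₁ M₁ klEngGeo8 P Q R β U μ j ∧ TwoLegSlopes L₁ M₁ R β U μ (klFlowFrameU L₁ M₁ β U μ j) j) →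
        TwoLegGridMomentsAtC L₁ M₁ Zt Zs₁ Zs₂ c β U μ (klFlowFrameU L₁ M₁ β U μ n') n')
    {d : ℝ} (hd : 0 ≤ d) (hdCL : d ≤ Q.CL β 0 / 4) {Dd Df Dc : ℕ → ℝ}
    (hDsum : ∀ n' ≤ n, Dd n' + Df n' ≤ d * (4 : ℝ) ^ n' / 3) (hDc : ∀ n' ≤ n, Dc n' ≤ d * (4 : ℝ) ^ n' / 3)
    (hdualSp : ∀ n' ≤ n, ∀ (Mq : ℕ → ℕ) (L₁ L₂ M₂ : ℕ) [NeZero L₁] [NeZero L₂] [NeZero M₂], L ≤ L₁ → L₁ ∣ L₂ → Q.M0 β L₁ ≤ M₂ →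
      Mq L₁ ≤ M₂ → Q.M0 β L₂ ≤ M₂ → Mq L₂ ≤ M₂ →
      (∀ j < n', histV17F2 L₁ M₂ klEngGeo8 P Q R β U μ j ∧ TwoLegSlopes L₁ M₂ R β U μ (klFlowFrameU L₁ M₂ β U μ j) j) →
      (∀ j < n', histV17F2 L₂ M₂ klEngGeo8 P Q R β U μ j ∧ TwoLegSlopes L₂ M₂ R β U μ (klFlowFrameU L₂ M₂ β U μ j) j) →
      (∀ m < n', ∀ θ : ℝ, |klLocalPart L₁ M₂ β U μ (klFlowFrameU L₁ M₂ β U μ m) m θ -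
        klLocalPart L₂ M₂ β U μ (klFlowFrameU L₂ M₂ β U μ m) m θ| ≤ d * (4 : ℝ) ^ m / L₁) →
      (∀ q : Fin 2 → ℝ, |(klFlowFrameU L₁ M₂ β U μ n').eval q - (klFlowFrameU L₂ M₂ β U μ n').eval q| ≤
        (∑ m ∈ range n', d * (4 : ℝ) ^ m) / L₁) →
      ∃ (oc : SpaceTimeIdx L₁ M₂) (of : SpaceTimeIdx L₂ M₂),
        (∀ m ∈ ({omega0 M₂, (omega0 M₂).rev} : Finset (MatsubaraIdx M₂)), ∀ σ : Fin 2, imagTimeWeight β M₂ * ∑ ybar : TorusSite 2 L₁,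
          (‖(∑ t₁ : ImagTimeIdx M₂,
              sectorisedKernel L₁ M₂ β (trivialMultiplier L₁ M₂)
                  (klEffectiveAction L₁ M₂ β U μ (klFlowFrameU L₁ M₂ β U μ n') klE0 n' - counterQuadratic L₁ M₂ β (klFlowFrameU L₁ M₂ β U μ n')) 2
                  (![((0, σ), 0), ((0, σ), 1)] : Fin 2 → SectorLeg 1) ![oc, (t₁, oc.2 + ybar)] *
                Complex.exp (((matsubaraFreq β M₂ m * (imagTime β M₂ oc.1 - imagTime β M₂ t₁) : ℝ) : ℂ) * I)) -
            (∑ t₁ : ImagTimeIdx M₂,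
              sectorisedKernel L₂ M₂ β (trivialMultiplier L₂ M₂)
                  (klEffectiveAction L₂ M₂ β U μ (klFlowFrameU L₂ M₂ β U μ n') klE0 n' - counterQuadratic L₂ M₂ β (klFlowFrameU L₂ M₂ β U μ n')) 2
                  (![((0, σ), 0), ((0, σ), 1)] : Fin 2 → SectorLeg 1) ![of, (t₁, of.2 + Torus.proj L₂ (Torus.cRep ybar))] *
                Complex.exp (((matsubaraFreq β M₂ m * (imagTime β M₂ of.1 - imagTime β M₂ t₁) : ℝ) : ℂ) * I))‖ +
          ‖(∑ t₁ : ImagTimeIdx M₂,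
              sectorisedKernel L₁ M₂ β (trivialMultiplier L₁ M₂)
                  (klEffectiveAction L₁ M₂ β U μ (klFlowFrameU L₁ M₂ β U μ n') klE0 n' - counterQuadratic L₁ M₂ β (klFlowFrameU L₁ M₂ β U μ n')) 2
                  (![((0, σ), 0), ((0, σ), 1)] : Fin 2 → SectorLeg 1) ![oc, (t₁, oc.2 + -ybar)] *
                Complex.exp (((matsubaraFreq β M₂ m * (imagTime β M₂ oc.1 - imagTime β M₂ t₁) : ℝ) : ℂ) * I)) -
            (∑ t₁ : ImagTimeIdx M₂,
              sectorisedKernel L₂ M₂ β (trivialMultiplier L₂ M₂)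
                  (klEffectiveAction L₂ M₂ β U μ (klFlowFrameU L₂ M₂ β U μ n') klE0 n' - counterQuadratic L₂ M₂ β (klFlowFrameU L₂ M₂ β U μ n')) 2
                  (![((0, σ), 0), ((0, σ), 1)] : Fin 2 → SectorLeg 1) ![of, (t₁, of.2 + -Torus.proj L₂ (Torus.cRep ybar))] *
                Complex.exp (((matsubaraFreq β M₂ m * (imagTime β M₂ of.1 - imagTime β M₂ t₁) : ℝ) : ℂ) * I))‖) ≤ Dd n' / L₁) ∧
        (∀ m ∈ ({omega0 M₂, (omega0 M₂).rev} : Finset (MatsubaraIdx M₂)), ∀ σ : Fin 2, imagTimeWeight β M₂ *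
          ∑ y ∈ univ.filter (fun y : TorusSite 2 L₂ => Torus.proj L₂ (Torus.cRep (fun i => (((y i).val : ℕ) : ZMod L₁))) ≠ y),
          (‖(∑ t₁ : ImagTimeIdx M₂,
              sectorisedKernel L₂ M₂ β (trivialMultiplier L₂ M₂)
                  (klEffectiveAction L₂ M₂ β U μ (klFlowFrameU L₂ M₂ β U μ n') klE0 n' - counterQuadratic L₂ M₂ β (klFlowFrameU L₂ M₂ β U μ n')) 2
                  (![((0, σ), 0), ((0, σ), 1)] : Fin 2 → SectorLeg 1) ![of, (t₁, of.2 + y)] *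
                Complex.exp (((matsubaraFreq β M₂ m * (imagTime β M₂ of.1 - imagTime β M₂ t₁) : ℝ) : ℂ) * I))‖ +
          ‖(∑ t₁ : ImagTimeIdx M₂,
              sectorisedKernel L₂ M₂ β (trivialMultiplier L₂ M₂)
                  (klEffectiveAction L₂ M₂ β U μ (klFlowFrameU L₂ M₂ β U μ n') klE0 n' - counterQuadratic L₂ M₂ β (klFlowFrameU L₂ M₂ β U μ n')) 2
                  (![((0, σ), 0), ((0, σ), 1)] : Fin 2 → SectorLeg 1) ![of, (t₁, of.2 + -y)] *
                Complex.exp (((matsubaraFreq β M₂ m * (imagTime β M₂ of.1 - imagTime β M₂ t₁) : ℝ) : ℂ) * I))‖) ≤ Df n' / L₁))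
    (hdualCut : ∀ n' ≤ n, ∀ (Mq : ℕ → ℕ) (L₁ M₁ M₂ : ℕ) [NeZero L₁] [NeZero M₁] [NeZero M₂], L ≤ L₁ → Q.M0 β L₁ ≤ M₁ → Mq L₁ ≤ M₁ →
      M₁ ≤ M₂ →
      (∀ j < n', histV17F2 L₁ M₁ klEngGeo8 P Q R β U μ j ∧ TwoLegSlopes L₁ M₁ R β U μ (klFlowFrameU L₁ M₁ β U μ j) j) →
      (∀ j < n', histV17F2 L₁ M₂ klEngGeo8 P Q R β U μ j ∧ TwoLegSlopes L₁ M₂ R β U μ (klFlowFrameU L₁ M₂ β U μ j) j) →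
      (∀ m < n', ∀ θ : ℝ, |klLocalPart L₁ M₁ β U μ (klFlowFrameU L₁ M₁ β U μ m) m θ -
        klLocalPart L₁ M₂ β U μ (klFlowFrameU L₁ M₂ β U μ m) m θ| ≤ d * (4 : ℝ) ^ m / L₁) →
      (∀ q : Fin 2 → ℝ, |(klFlowFrameU L₁ M₁ β U μ n').eval q - (klFlowFrameU L₁ M₂ β U μ n').eval q| ≤
        (∑ m ∈ range n', d * (4 : ℝ) ^ m) / L₁) →
      ∃ (o₁ : SpaceTimeIdx L₁ M₁) (o₂ : SpaceTimeIdx L₁ M₂),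
        (∀ σ : Fin 2, ∑ y : TorusSite 2 L₁,
          (‖(imagTimeWeight β M₁ : ℂ) * (∑ t₁ : ImagTimeIdx M₁,
              sectorisedKernel L₁ M₁ β (trivialMultiplier L₁ M₁)
                  (klEffectiveAction L₁ M₁ β U μ (klFlowFrameU L₁ M₁ β U μ n') klE0 n' - counterQuadratic L₁ M₁ β (klFlowFrameU L₁ M₁ β U μ n')) 2
                  (![((0, σ), 0), ((0, σ), 1)] : Fin 2 → SectorLeg 1) ![o₁, (t₁, o₁.2 + y)] *
                Complex.exp (((matsubaraFreq β M₁ (omega0 M₁) * (imagTime β M₁ o₁.1 - imagTime β M₁ t₁) : ℝ) : ℂ) * I)) -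
            (imagTimeWeight β M₂ : ℂ) * (∑ t₁ : ImagTimeIdx M₂,
              sectorisedKernel L₁ M₂ β (trivialMultiplier L₁ M₂)
                  (klEffectiveAction L₁ M₂ β U μ (klFlowFrameU L₁ M₂ β U μ n') klE0 n' - counterQuadratic L₁ M₂ β (klFlowFrameU L₁ M₂ β U μ n')) 2
                  (![((0, σ), 0), ((0, σ), 1)] : Fin 2 → SectorLeg 1) ![o₂, (t₁, o₂.2 + y)] *
                Complex.exp (((matsubaraFreq β M₂ (omega0 M₂) * (imagTime β M₂ o₂.1 - imagTime β M₂ t₁) : ℝ) : ℂ) * I))‖ +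
          ‖(imagTimeWeight β M₁ : ℂ) * (∑ t₁ : ImagTimeIdx M₁,
              sectorisedKernel L₁ M₁ β (trivialMultiplier L₁ M₁)
                  (klEffectiveAction L₁ M₁ β U μ (klFlowFrameU L₁ M₁ β U μ n') klE0 n' - counterQuadratic L₁ M₁ β (klFlowFrameU L₁ M₁ β U μ n')) 2
                  (![((0, σ), 0), ((0, σ), 1)] : Fin 2 → SectorLeg 1) ![o₁, (t₁, o₁.2 + -y)] *
                Complex.exp (((matsubaraFreq β M₁ (omega0 M₁) * (imagTime β M₁ o₁.1 - imagTime β M₁ t₁) : ℝ) : ℂ) * I)) -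
            (imagTimeWeight β M₂ : ℂ) * (∑ t₁ : ImagTimeIdx M₂,
              sectorisedKernel L₁ M₂ β (trivialMultiplier L₁ M₂)
                  (klEffectiveAction L₁ M₂ β U μ (klFlowFrameU L₁ M₂ β U μ n') klE0 n' - counterQuadratic L₁ M₂ β (klFlowFrameU L₁ M₂ β U μ n')) 2
                  (![((0, σ), 0), ((0, σ), 1)] : Fin 2 → SectorLeg 1) ![o₂, (t₁, o₂.2 + -y)] *
                Complex.exp (((matsubaraFreq β M₂ (omega0 M₂) * (imagTime β M₂ o₂.1 - imagTime β M₂ t₁) : ℝ) : ℂ) * I))‖) ≤ Dc n' / L₁) ∧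
        (∀ σ : Fin 2, ∑ y : TorusSite 2 L₁,
          (‖(imagTimeWeight β M₁ : ℂ) * (∑ t₁ : ImagTimeIdx M₁,
              sectorisedKernel L₁ M₁ β (trivialMultiplier L₁ M₁)
                  (klEffectiveAction L₁ M₁ β U μ (klFlowFrameU L₁ M₁ β U μ n') klE0 n' - counterQuadratic L₁ M₁ β (klFlowFrameU L₁ M₁ β U μ n')) 2
                  (![((0, σ), 0), ((0, σ), 1)] : Fin 2 → SectorLeg 1) ![o₁, (t₁, o₁.2 + y)] *
                Complex.exp (((matsubaraFreq β M₁ (omega0 M₁).rev * (imagTime β M₁ o₁.1 - imagTime β M₁ t₁) : ℝ) : ℂ) * I)) -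
            (imagTimeWeight β M₂ : ℂ) * (∑ t₁ : ImagTimeIdx M₂,
              sectorisedKernel L₁ M₂ β (trivialMultiplier L₁ M₂)
                  (klEffectiveAction L₁ M₂ β U μ (klFlowFrameU L₁ M₂ β U μ n') klE0 n' - counterQuadratic L₁ M₂ β (klFlowFrameU L₁ M₂ β U μ n')) 2
                  (![((0, σ), 0), ((0, σ), 1)] : Fin 2 → SectorLeg 1) ![o₂, (t₁, o₂.2 + y)] *
                Complex.exp (((matsubaraFreq β M₂ (omega0 M₂).rev * (imagTime β M₂ o₂.1 - imagTime β M₂ t₁) : ℝ) : ℂ) * I))‖ +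
          ‖(imagTimeWeight β M₁ : ℂ) * (∑ t₁ : ImagTimeIdx M₁,
              sectorisedKernel L₁ M₁ β (trivialMultiplier L₁ M₁)
                  (klEffectiveAction L₁ M₁ β U μ (klFlowFrameU L₁ M₁ β U μ n') klE0 n' - counterQuadratic L₁ M₁ β (klFlowFrameU L₁ M₁ β U μ n')) 2
                  (![((0, σ), 0), ((0, σ), 1)] : Fin 2 → SectorLeg 1) ![o₁, (t₁, o₁.2 + -y)] *
                Complex.exp (((matsubaraFreq β M₁ (omega0 M₁).rev * (imagTime β M₁ o₁.1 - imagTime β M₁ t₁) : ℝ) : ℂ) * I)) -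
            (imagTimeWeight β M₂ : ℂ) * (∑ t₁ : ImagTimeIdx M₂,
              sectorisedKernel L₁ M₂ β (trivialMultiplier L₁ M₂)
                  (klEffectiveAction L₁ M₂ β U μ (klFlowFrameU L₁ M₂ β U μ n') klE0 n' - counterQuadratic L₁ M₂ β (klFlowFrameU L₁ M₂ β U μ n')) 2
                  (![((0, σ), 0), ((0, σ), 1)] : Fin 2 → SectorLeg 1) ![o₂, (t₁, o₂.2 + -y)] *
                Complex.exp (((matsubaraFreq β M₂ (omega0 M₂).rev * (imagTime β M₂ o₂.1 - imagTime β M₂ t₁) : ℝ) : ℂ) * I))‖) ≤ Dc n' / L₁)) :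
    TwoLegStepV17F2 L M klEngGeo8 P Q R β U μ n := by
  have _ := hP; have _ := hn1; have _ := hreg; have _ := hE
  -- regime conversions from the registered thresholds
  have hRge : ∀ j, 0 ≤ R.Gfr j := hR.1.2.2
  have hcz : 0 < R.cz := hR.2.2
  have hcle : c ≤ klCurveC3 R := hc3.trans ((klEngC₃6_le_klEngC₃3 P R).trans (klEngC₃3_le_klCurveC3 P hRge))
  have hc33 : c ≤ klEngC₃3 P R := hc3.trans (klEngC₃6_le_klEngC₃3 P R)
  have hU9 : U ≤ klEngU₀9 P R c := hUle.trans (klEngU₀10_le_klEngU₀9 P R c)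
  have hU4 : U ≤ klEngU₀4 P R c := hUle.trans (klEngU₀10_le_klEngU₀4 P R c)
  have hU3 : U ≤ klEngU₀3 P R c := hU9.trans (klEngU₀9_le_klEngU₀3 P R c)
  have hUc : U ≤ klCurveU0 R := hU3.trans (klEngU₀3_le_klCurveU0 P hRge c)
  have hUall : U ≤ klE3U₀all R := hUle.trans (klEngU₀10_le_klE3U₀all P R c)
  have hL3 : klEngL₃ β U ≤ L := klEngL₃_le_of_klEngL₄_le hL
  have h0 : FrameOK R U (nScales β) μ 0 := klFrameOK_zeroC hR.1 U (nScales β) hμ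
  have hβ0 : 0 < β := lt_of_lt_of_le (by norm_num [klBetaMin]) hβ
  have hU0 : U ≠ 0 := hU.ne'
  -- package rows along the raise
  have hCL : ∀ n' ≤ n, Q.CL β 0 * (4 : ℝ) ^ n' ≤ Q.CL β n' := fun n' _ => le_of_eq (by
    rw [hQ.CL_eq, klEngQ7_CL_apply, klEngQ7_CL_apply]; ring)
  have hM0 : Q.M0 β L ≤ M := by rw [hQ.M0_eq]; exact hM
  have hGS : ∀ k, cJ k ≤ klEngGeo8.S k := fun k => by rw [klEngGeo8_S]; exact hC k
  have hQS : ∀ k, klC4aJetC' P R k ≤ Q.S' k := fun k => by rw [hQ.S'_eq]; exact klC4aJetC'_le_klEngQ7_S' P R k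
  have hQCL : 0 ≤ Q.CL β n := by rw [hQ.CL_eq]; exact klEngQ7_CL_nonneg P R β n
  -- the ĉ row, split
  have hĉ0 : 0 ≤ c / Real.log 4 + U ^ 2 := cHat_nonneg hc.le U
  have hrow600 : Zs₁ * (c / Real.log 4 + U ^ 2) ≤ R.cz / 600 := hrow.trans (min_le_left _ _)
  have hrow10 : Zs₁ * (c / Real.log 4 + U ^ 2) ≤ 1 / 10 := hrow.trans (min_le_right _ _)
  -- rows B1′/B2′ at the base volume: the C-atom at (L, M, n) with the slopes history from `HistP`
  have hgridC : TwoLegGridFlowMomentsAtC L M Zt Zs₁ Zs₂ c β U μ n :=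
    hGs n le_rfl L M le_rfl hM0 (fun j hj => ⟨histV17F2_of_histP hhist j hj, ((histP_klPredsV17F2_iff L M klEngGeo8 P Q R β U μ 0 n).1 hhist j hj).2.2.2.2.1⟩)
  have hgrid : TwoLegGridFlowMomentsAt L M Zt (Zs₁ * (c / Real.log 4 + U ^ 2) / |U| + Zs₂) β U μ n := hgridC.toFlowMomentsAt hU0
  obtain ⟨hZt0, hZs0⟩ := hgrid.budget_nonneg hβ0 hU0
  -- the n-free smallness of the nested legs in the mixed currency
  have hsmall := twoLeg_gridLegSmallnessC_of_doors (c := c) (Zs₁ := Zs₁) (Zs₂ := Zs₂) (hRge 0) (hRge 1) hU hUall hUc hrow10 hS₂a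
  -- row C2 and row C1 from the grid binder (through `.toMomentsAt`) and the VL rows
  have hsp := spLeg_allScales_of_gridMoments_V17F2_geometric4 (G := klEngGeo8) (P := P) hRge hc hcle hU hUc hβ hβc hμ hL3 h0 hn hd hdCL hCL
    hZs0 hsmall hDsum (fun n'' hn'' Mq L₁ L₂ M₂ _ _ _ hLL₁ _ hM₁ _ _ _ hh₁ _ _ _ => (hGs n'' hn'' L₁ M₂ hLL₁ hM₁ hh₁).toMomentsAt hU0) hdualSp n le_rfl
  have hcut := cutLeg_allScales_of_gridMoments_V17F2_geometric4 (G := klEngGeo8) (P := P) hRge hc hcle hU hUc hβ hβc hμ hL3 h0 hn hd hdCL hCL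
    hZs0 hsmall hDc (fun n'' hn'' Mq L₁ M₁ M₂ _ _ _ hLL₁ hM₁ _ _ hh₁ _ _ _ => (hGs n'' hn'' L₁ M₁ hLL₁ hM₁ hh₁).toMomentsAt hU0) hdualCut n le_rfl
  -- the slope sizes in the mixed currency and their fits
  obtain ⟨hzt, hms⟩ := twoLeg_slopeSizes_of_twoLegGridMomentsAtC hβ0 hU0 ((twoLegGridFlowMomentsAtC_iff Zt Zs₁ Zs₂ c β U μ n).1 hgridC)
  have hz : ∀ k ∈ klShell L μ (klFlowFrameU L M β U μ n) n,
      |klFieldStrength L M β U μ (klFlowFrameU L M β U μ n) n k - 1| ≤ R.cz * |U| := fun k _ =>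
    fieldStrength_fit_of_size hcz hU hUall hZa (hzt k)
  have hfit1 := mixed_slope_fit (c := c) hcz hU hUall hrow600 hS₂a
  exact twoLegStepV17F2_of_jets_sepTubeGradient_nestedLegs_pkg klEngGeo8 Q P hR hc hc33 hμ hU hU4 hβ hβc hL3 hn hfr hQCL hGS hQS hJ.1 hJ.2 hz
    (fun q _ => hms q) hfit1 hcut hsp

end Summit.HubbardSuperconductivity.HubbardSuperconductivity.Theorems.EngineV8

end
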